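import Mathlib
import Summits.CriticalPhenomena.CardyFormulaZ2.Theses.CardyFlipRusso
import Literature.Probability.Percolation.CardyFormula
import Literature.Analysis.FunctionSpaces.PoissonPointProcess

/-!
# Sketch — crux-ideate stmt-CriticalPhenomena-6434 (SquareFromVoronoiHub), ideator 2, round 1

First lemmas of the two idea cards, stated over existing declarations (they need not be proved
here; they must elaborate).

* Card `voronoi-blocks-on-fixed-gs`: `BlockWalshIdentity` (the exact lever) and the transferred
  crux `BlockColouringInvariance` (C⁺).
* Card `centre-coin-is-fair-diagonal`: `FaceCentreDiagonalIdentity` (the exact lever, decided by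
  `decide`).
-/

open scoped Classical Pointwise
open MeasureTheory Filter Topology Finset

namespace Summit.CriticalPhenomena.CardyFormulaZ2.Cruxes.SquareFromVoronoiHub.Sketch

/-! ## Card 1 — Voronoi blocks on the fixed lattice `G_s` -/

section Walsh

variable {V β : Type*} [Fintype V] [Fintype β]

/-- Walsh–Fourier coefficient `ĝ(A) = E_unif[g σ_A]` of `g` under the fair i.i.d. colouring. -/
noncomputable def walsh (g : (V → Bool) → ℝ) (A : Finset V) : ℝ :=
  (Fintype.card (V → Bool) : ℝ)⁻¹ * ∑ σ : V → Bool, g σ * ∏ v ∈ A, (if σ v then (1 : ℝ) else -1)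

/-- Expectation of `g` under the BLOCK-constant fair colouring with block map `blk : V → β`
(one fair coin per block; sites of a block share it). -/
noncomputable def blockExpect (blk : V → β) (g : (V → Bool) → ℝ) : ℝ :=
  (Fintype.card (β → Bool) : ℝ)⁻¹ * ∑ c : β → Bool, g (c ∘ blk)

/-- `A` meets every block in an even number of sites. -/
def EvenInBlocks (blk : V → β) (A : Finset V) : Prop :=
  ∀ b : β, Even ((A.filter fun v => blk v = b).card)

end Walsh

/-- FIRST LEMMA of card `voronoi-blocks-on-fixed-gs` (exact, elementary; the lever):
block-colouring expectation = even Walsh mass,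
`E_block[g] = Σ_{A even in every block} ĝ(A)` — the Radon–Nikodym density of the block-constant
fair colouring w.r.t. the i.i.d. fair colouring is `Π_blocks Σ_{A ⊆ b, |A| even} σ_A`. -/
def BlockWalshIdentity : Prop :=
  ∀ (V β : Type) [Fintype V] [Fintype β] (blk : V → β) (g : (V → Bool) → ℝ),
    blockExpect blk g = ∑ A ∈ (Finset.univ : Finset (Finset V)).filter (EvenInBlocks blk), walsh g A

/-- The centred square lattice `G_s` exactly as in the route file (vertex positions `z`, graph `G`). -/
noncomputable def zGs : (ℤ × ℤ) ⊕ (ℤ × ℤ) → ℂ :=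
  Sum.elim (fun x ↦ (x.1 : ℂ) + (x.2 : ℂ) * Complex.I)
    (fun f ↦ ((f.1 : ℂ) + 1 / 2) + ((f.2 : ℂ) + 1 / 2) * Complex.I)

/-- The graph `G_s` (ℤ² edges + centre-to-corner edges), verbatim from the route decl. -/
noncomputable def Gs : SimpleGraph ((ℤ × ℤ) ⊕ (ℤ × ℤ)) :=
  SimpleGraph.fromRel (fun a b ↦ a.isLeft = true ∧
    ((b.isLeft = true ∧ dist (zGs a) (zGs b) = 1) ∨ (b.isRight = true ∧ dist (zGs a) (zGs b) < 1)))

/-- The Voronoi-BLOCK colouring of `G_s` at mesh `δ` read off a pair of nucleus configurations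
`c = (black nuclei, white nuclei)` dilated by the cell scale `s`: site `y` is black iff its
position `δ·z y` is at least as close to a black nucleus as to a white one. -/
noncomputable def blockConfig (δ s : ℝ)
    (c : Literature.Analysis.FunctionSpaces.PointConfig ℂ × Literature.Analysis.FunctionSpaces.PointConfig ℂ) :
    Literature.Probability.Percolation.SiteConfig ((ℤ × ℤ) ⊕ (ℤ × ℤ)) :=
  {y | Metric.infDist ((δ : ℂ) * zGs y) ((s : ℂ) • (c.1 : Set ℂ)) ≤
        Metric.infDist ((δ : ℂ) * zGs y) ((s : ℂ) • (c.2 : Set ℂ))}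

/-- Crude crossing probability of the conformal rectangle `R` for the block colouring at mesh `δ`,
cell scale `s` (same crude event as the crux's conclusion: endpoints within `2δ` of the arcs,
path inside `Ω`). At `s ≪ δ/log(1/δ)` this is site percolation on `G_s` up to `o(1)`; at
`s ≫ δ^{1/3}` it is a faithful discretisation of Poisson–Voronoi percolation at cell scale `s`. -/
noncomputable def blockCrossingProb
    (PB PW : Measure (Literature.Analysis.FunctionSpaces.PointConfig ℂ))
    (R : Literature.Probability.RandomPlanarGeometry.ConformalRectangle) (δ s : ℝ) : ℝ :=
  (PB.prod PW).real {c | ∃ u v, Metric.infDist ((δ : ℂ) * zGs u) (R.arc 0) ≤ 2 * δ ∧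
      Metric.infDist ((δ : ℂ) * zGs v) (R.arc 2) ≤ 2 * δ ∧
      blockConfig δ s c ∈ Literature.Probability.Percolation.siteConnIn Gs
        {y | (δ : ℂ) * zGs y ∈ R.carrier} u v}

/-- TRANSFERRED CRUX C⁺ of card `voronoi-blocks-on-fixed-gs` (BLOCK-COLOURING INVARIANCE on the
fixed lattice): along any two cell-scale schedules inside the window `δ² ≤ s(δ) ≤ δ^{1/4}` the
crude crossing probabilities of the Voronoi-block colouring of `G_s` are asymptotically equal.
With K1 (faithful discretisation at `s = δ^{1/4}`) and K0 (`s = δ²` is site percolation up to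
`o(1)`) this implies `SquareFromVoronoiHub`. -/
def BlockColouringInvariance : Prop :=
  ∀ (PB PW : Measure (Literature.Analysis.FunctionSpaces.PointConfig ℂ)),
    Literature.Analysis.FunctionSpaces.IsPoissonPointProcess (volume : Measure ℂ) PB →
    Literature.Analysis.FunctionSpaces.IsPoissonPointProcess (volume : Measure ℂ) PW →
    ∀ (R : Literature.Probability.RandomPlanarGeometry.ConformalRectangle) (s₁ s₂ : ℝ → ℝ),
      (∀ δ ∈ Set.Ioo (0 : ℝ) 1, δ ^ 2 ≤ s₁ δ ∧ s₁ δ ≤ δ ^ (1 / 4 : ℝ)) →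
      (∀ δ ∈ Set.Ioo (0 : ℝ) 1, δ ^ 2 ≤ s₂ δ ∧ s₂ δ ≤ δ ^ (1 / 4 : ℝ)) →
      Tendsto (fun δ => blockCrossingProb PB PW R δ (s₁ δ) - blockCrossingProb PB PW R δ (s₂ δ))
        (𝓝[>] 0) (𝓝 0)

/-- K1 of the card (faithful discretisation, support-level): at cell scale `s = δ^{1/4}` the block
crossing probability and the continuum Poisson–Voronoi crossing probability (the crux's hypothesis
event, nuclei rescaled by `s`) differ by `o(1)`. -/
def FaithfulDiscretisation : Prop :=
  ∀ (PB PW : Measure (Literature.Analysis.FunctionSpaces.PointConfig ℂ)),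
    Literature.Analysis.FunctionSpaces.IsPoissonPointProcess (volume : Measure ℂ) PB →
    Literature.Analysis.FunctionSpaces.IsPoissonPointProcess (volume : Measure ℂ) PW →
    ∀ (R : Literature.Probability.RandomPlanarGeometry.ConformalRectangle),
      Tendsto (fun δ : ℝ => blockCrossingProb PB PW R δ (δ ^ (1 / 4 : ℝ)) -
        (PB.prod PW).real {c | ∃ x ∈ R.arc 0, ∃ y ∈ R.arc 2,
          JoinedIn (closure R.carrier ∩ {w | Metric.infDist (w / ((δ ^ (1 / 4 : ℝ) : ℝ) : ℂ)) (c.1 : Set ℂ) ≤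
            Metric.infDist (w / ((δ ^ (1 / 4 : ℝ) : ℝ) : ℂ)) (c.2 : Set ℂ)}) x y})
        (𝓝[>] 0) (𝓝 0)

/-! ## Card 2 — a fair centre coin is a fair random diagonal -/

/-- Corners `0,1,2,3` of a square face in cyclic order; side adjacency. -/
def sideAdj (i j : Fin 4) : Prop := j = i + 1 ∨ i = j + 1

/-- Monochromatic connectivity of corners `i, j` INSIDE the closed face, given the corner colours
`κ` and an extra joining device `extra` (a centre vertex or a diagonal): adjacent equal corners
are joined by the side; opposite equal corners are joined iff an intermediate corner has their
colour or the extra device joins them. -/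
def faceConn (κ : Fin 4 → Bool) (extra : Fin 4 → Fin 4 → Prop) (i j : Fin 4) : Prop :=
  κ i = κ j ∧ (i = j ∨ sideAdj i j ∨
    (j = i + 2 ∧ (κ (i + 1) = κ i ∨ κ (i + 3) = κ i ∨ extra i j)))

/-- Device 1: a centre vertex of colour `c` joined to the four corners (the degree-4 centres of
`G_s`): it joins two corners iff it has their colour. -/
def extraCentre (κ : Fin 4 → Bool) (c : Bool) (i _j : Fin 4) : Prop := c = κ i

/-- Device 2: one diagonal, `d = true` ↦ the diagonal `{0,2}`, `d = false` ↦ `{1,3}`. -/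
def extraDiag (d : Bool) (i j : Fin 4) : Prop :=
  (d = true ∧ ((i = 0 ∧ j = 2) ∨ (i = 2 ∧ j = 0))) ∨ (d = false ∧ ((i = 1 ∧ j = 3) ∨ (i = 3 ∧ j = 1)))

/-- FIRST LEMMA of card `centre-coin-is-fair-diagonal` (exact, decidable; the lever): for every
corner colouring there is a relabelling of the coin (`d ↦ d xor t`) under which "fair random
diagonal" and "fair centre vertex" induce the SAME connectivity among the corners — so site
percolation at 1/2 on `G_s`, restricted to `ℤ²`, is `ℤ²` site percolation with i.i.d. fair
diagonals (Rolla's disordered triangulation, arXiv:1704.04930), face by face and pathwise. -/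
def FaceCentreDiagonalIdentity : Prop :=
  ∀ κ : Fin 4 → Bool, ∃ t : Bool, ∀ (d : Bool) (i j : Fin 4),
    faceConn κ (extraDiag d) i j ↔ faceConn κ (extraCentre κ (xor d t)) i j

instance (κ : Fin 4 → Bool) (extra : Fin 4 → Fin 4 → Prop) [∀ i j, Decidable (extra i j)]
    (i j : Fin 4) : Decidable (faceConn κ extra i j) := by
  unfold faceConn sideAdj; infer_instance

instance (κ : Fin 4 → Bool) (c : Bool) (i j : Fin 4) : Decidable (extraCentre κ c i j) := by
  unfold extraCentre; infer_instance

instance (d : Bool) (i j : Fin 4) : Decidable (extraDiag d i j) := by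
  unfold extraDiag; infer_instance

/-- The face identity, machine-checked. -/
theorem faceCentreDiagonalIdentity_holds : FaceCentreDiagonalIdentity := by
  unfold FaceCentreDiagonalIdentity
  decide

/-- Sanity: the transferred crux is a statement about the SAME lattice event as the crux's
conclusion (the route decl is importable). -/
example : Prop := Summit.CriticalPhenomena.CardyFormulaZ2.Theses.CardyFlipRusso.SquareFromVoronoiHub

end Summit.CriticalPhenomena.CardyFormulaZ2.Cruxes.SquareFromVoronoiHub.Sketch
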